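import Mathlib.Analysis.InnerProductSpace.Adjoint
import Mathlib.Analysis.InnerProductSpace.Spectrum
import Mathlib.Analysis.Matrix.Spectrum
import Mathlib.Analysis.Calculus.FDeriv.Basic
import Literature.Analysis.InnerProduct.KyFanTwoSmallest
import Literature.Analysis.FluidPDE.VectorCalculus
import HarnessLib

/-!
# The Leray-gauge strain spectrum: middle strain eigenvalue and nilpotency defect

Topic `Literature/Analysis/FluidPDE` (definition request `defn-LerayGaugeStrainSpectrum` of route
`SqueezeCycle`, Navier–Stokes regularity). For a velocity field `u : ℝ → ℝ³ → ℝ³`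
(`ℝ³ = EuclideanSpace ℝ (Fin 3)`), a time `t < 0` and a point `x`, write `A = ∇u(t, x) =
fderiv ℝ (u t) x` and `S = ½ (A + Aᵀ)` for the strain (rate-of-deformation) tensor, with
eigenvalues `λ₁ ≥ λ₂ ≥ λ₃` (Mathlib's decreasing enumeration; Miller 2019 writes them increasingly,
the *middle* one `λ₂` is the same). This file provides

* `addAdjoint A = A + A†` (twice the symmetric part) for a linear map `A` of a finite-dimensional
  real inner product space, `isSymmetric_addAdjoint`, `inner_addAdjoint_apply_self`
  (`⟪(A + A†) y, y⟫ = 2 ⟪A y, y⟫`);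
* `strainEigenvalues A hn : Fin n → ℝ` — the eigenvalues of `½ (A + A†)` ("principal strains"),
  decreasing (`strainEigenvalues_antitone`), through `LinearMap.IsSymmetric.eigenvalues`;
* the **Courant–Fischer characterisation of the middle eigenvalue in dimension three** in the
  *two-frame form* used verbatim by the route items (Horn–Johnson, Thm. 4.2.6 with `n = 3`,
  `k = 2`: both the min–max and the max–min run over planes): for symmetric `T`,
  `μ₂ ≤ a ↔ ∃ orthonormal v w, ∀ α β, ⟪T (αv + βw), αv + βw⟫ ≤ a (α² + β²)`
  (`eigenvalues_mid_le_iff`) and `a ≤ μ₂ ↔ ∃ orthonormal v w, ∀ α β, a (α² + β²) ≤ ⟪T (αv + βw),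
  αv + βw⟫` (`le_eigenvalues_mid_iff`), with the strain versions `strainEigenvalues_mid_le_iff`,
  `le_strainEigenvalues_mid_iff` (quadratic form of `A` itself, since `⟪S y, y⟫ = ⟪A y, y⟫`);
  they rest on the one-sided Rayleigh bounds `inner_apply_self_le_eigenvalues_mul_norm_sq` /
  `eigenvalues_mul_norm_sq_le_inner_apply_self` (general `n`, `k`: the two easy halves of
  Courant–Fischer) and an explicit vector of a plane orthogonal to a given vector
  (`exists_smul_add_smul_inner_eq_zero`), so no dimension count of subspace intersections is needed;
* `lerayMiddleStrain u t x = (−t) · λ₂(S)` — the middle strain eigenvalue in the backward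
  self-similar (Leray) gauge: lengths scale like `√(−t)`, velocity gradients like `1/(−t)`, so
  `(−t) λ₂` is dimensionless and invariant under the Navier–Stokes scaling
  `u ↦ λ u(λ² t, λ x)` about the origin of space-time;
  `lerayMiddleStrain_le_iff` / `le_lerayMiddleStrain_iff` are *literally* the inline forms of the
  route items `MustSqueeze`, `ExtremalElementExists`, `ExtremalBiaxialitySubcritical`
  (`∃ v w, ‖v‖ = 1 ∧ ‖w‖ = 1 ∧ ⟪v, w⟫ = 0 ∧ ∀ α β, (−t) * ⟪∇u (αv+βw), αv+βw⟫ ≤ a * (α²+β²)`, resp.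
  `m * (α²+β²) ≤ (−t) * ⟪…⟫`);
* `gaugeNilpotencyDefect u t x = (−t) ‖A ∘ A‖_F / ‖A‖_F` (Frobenius norms, via the tree's
  `frobeniusNormSq`; value `0` when `A = 0` by `x / 0 = 0`), vanishing exactly when `A² = 0`
  (`gaugeNilpotencyDefect_eq_zero_iff`), i.e. on the rank-`≤ 1` nilpotent gradients `a ⊗ b`,
  `a · b = 0` (pure shear layers);
* the **matrix bridge** to the route's support items `MiddleEigenvalueSign`, `BiaxialityDefect`,
  which speak of `(Matrix.isHermitian_add_transpose_self M).eigenvalues₀ 1` and `∑ᵢⱼ Mᵢⱼ²` for a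
  `3 × 3` real matrix: with `stdMatrix A` the matrix of `A` in the standard basis
  (`(stdMatrix A) i j = (A eⱼ)ᵢ = ∂ⱼ uᵢ`), `strainEigenvalues_eq_eigenvalues₀`,
  `lerayMiddleStrain_eq_eigenvalues₀`, `frobeniusNormSq_eq_sum_sq_stdMatrix`,
  `stdMatrix_comp`, `trace_stdMatrix` (`= div`), `curl_eq_stdMatrix` (the `ω` of item `SignLaw`).

## Design notes / what is NOT here

* Everything is stated for the Fréchet derivative `fderiv` (junk `0` where `u t` is not
  differentiable, as everywhere in the fluid prelude). For `t ≥ 0` the gauge factor `−t ≤ 0` makes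
  `lerayMiddleStrain`/`gaugeNilpotencyDefect` meaningless (they are `0` at `t = 0`); all linking
  lemmas assume `t < 0`.
* The strain tensor as an operator is not re-defined: `½ • addAdjoint ↑(fderiv ℝ v x)` is the
  coercion of `strainRateWithin v univ x` (`SlipCylinderClassicalNS.lean`, `fderivWithin_univ`);
  that file is not imported here only to keep the import closure small. `spin` of
  `VectorCalculus.lean` is the antisymmetric companion `A − A†`.
* Not here: the general-`k` Courant–Fischer theorem over subspaces (only the one-sided Rayleigh
  bounds for all `k` and the full statement for the middle eigenvalue of three), Weyl/Lidskii
  perturbation inequalities, continuity of `λ₂` in `A`, the sign law `ω · Sω = 4 det ∇u − 4 det S`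
  and the inequalities `ShearEndpoint`/`BiaxialityDefect` (route items, to be proved there).

## References

* R. A. Horn, C. R. Johnson, *Matrix Analysis*, 2nd ed., CUP (2013), Thm. 4.2.6 (Courant–Fischer),
  p. 236. [HornJohnson2013]
* E. Miller, *A regularity criterion for the Navier–Stokes equation involving only the middle
  eigenvalue of the strain tensor*, ARMA 235 (2020) 99–139 = arXiv:1710.05569, Thm. 1.1 (the
  eigenvalues `λ₁ ≤ λ₂ ≤ λ₃` of `S = ∇_sym u`), Lemma 5.1 (`−det S ≤ ½ |S|² λ₂⁺`). [Miller2019]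
* J. Neustupa, P. Penel, *Anisotropic and geometric criteria for interior regularity…*, in
  Mathematical Fluid Mechanics, Birkhäuser (2001) 237–265. [NeustupaPenel2001]
-/

noncomputable section

open scoped InnerProductSpace Matrix
open Module Finset

namespace Literature.Analysis.FluidPDE

/-! ### Orthonormal two-frames -/

section Frames

variable {V : Type*} [NormedAddCommGroup V] [InnerProductSpace ℝ V]

/-- `‖α v + β w‖² = α² + β²` for an orthonormal pair `v, w`. [folklore] -/
theorem norm_sq_smul_add_smul {v w : V} (hv : ‖v‖ = 1) (hw : ‖w‖ = 1) (hvw : ⟪v, w⟫_ℝ = 0)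
    (α β : ℝ) : ‖α • v + β • w‖ ^ 2 = α ^ 2 + β ^ 2 := by
  rw [← real_inner_self_eq_norm_sq]
  simp only [inner_add_left, inner_add_right, real_inner_smul_left, real_inner_smul_right]
  simp only [real_inner_self_eq_norm_sq, hv, hw, hvw, real_inner_comm v w]
  ring

/-- Every plane `span {v, w}` contains a vector `α v + β w` with `(α, β) ≠ 0` orthogonal to a given
vector `z` (explicitly `α = ⟪z, w⟫`, `β = −⟪z, v⟫`, or `v` itself when `z ⊥ v`) — the
`dim S + dim S' = n + 1` step of Horn–Johnson's proof of Courant–Fischer for `n = 3`, made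
explicit. [folklore] -/
theorem exists_smul_add_smul_inner_eq_zero (z v w : V) :
    ∃ α β : ℝ, 0 < α ^ 2 + β ^ 2 ∧ ⟪z, α • v + β • w⟫_ℝ = 0 := by
  by_cases h : ⟪z, v⟫_ℝ = 0
  · exact ⟨1, 0, by norm_num, by simp [h]⟩
  · refine ⟨⟪z, w⟫_ℝ, -⟪z, v⟫_ℝ, ?_, ?_⟩
    · have h2 : 0 < ⟪z, v⟫_ℝ ^ 2 := lt_of_le_of_ne (sq_nonneg _) (pow_ne_zero 2 h).symm
      nlinarith [sq_nonneg ⟪z, w⟫_ℝ, h2]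
    · simp only [inner_add_right, real_inner_smul_right]
      ring

end Frames

/-! ### One-sided Rayleigh bounds and Courant–Fischer for the middle eigenvalue of three -/

section Rayleigh

variable {V : Type*} [NormedAddCommGroup V] [InnerProductSpace ℝ V] [FiniteDimensional ℝ V]
  {T : V →ₗ[ℝ] V}

open Literature.Analysis.InnerProduct in
/-- **Upper one-sided Rayleigh bound.** If `x` is orthogonal to the eigenvectors `b₀, …, b_{k-1}`
of the `k` largest eigenvalues of a symmetric `T` (Mathlib's decreasing enumeration), then
`⟪T x, x⟫ ≤ μ_k ‖x‖²` — the easy half of Courant–Fischer (the maximum of the Rayleigh quotient over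
`span {b_k, …, b_{n-1}}` is `μ_k`: the attained case of Horn–Johnson's min–max (4.2.7)).
[cite: HornJohnson2013, Thm 4.2.6] -/
theorem inner_apply_self_le_eigenvalues_mul_norm_sq (hT : T.IsSymmetric) {n : ℕ}
    (hn : finrank ℝ V = n) (k : Fin n) {x : V}
    (hx : ∀ i : Fin n, i < k → ⟪hT.eigenvectorBasis hn i, x⟫_ℝ = 0) :
    ⟪T x, x⟫_ℝ ≤ hT.eigenvalues hn k * ‖x‖ ^ 2 := by
  rw [inner_apply_self_eq_sum_eigenvalues hT hn x, ← (hT.eigenvectorBasis hn).sum_sq_inner_right x,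
    Finset.mul_sum]
  refine Finset.sum_le_sum fun i _ => ?_
  by_cases hi : i < k
  · rw [hx i hi]
    simp
  · exact mul_le_mul_of_nonneg_right (hT.eigenvalues_antitone hn (not_lt.mp hi)) (sq_nonneg _)

open Literature.Analysis.InnerProduct in
/-- **Lower one-sided Rayleigh bound.** If `x` is orthogonal to the eigenvectors `b_{k+1}, …,
b_{n-1}` of the `n - k - 1` smallest eigenvalues of a symmetric `T`, then `μ_k ‖x‖² ≤ ⟪T x, x⟫`
(the minimum of the Rayleigh quotient over `span {b₀, …, b_k}` is `μ_k`: the attained case of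
Horn–Johnson's max–min (4.2.8)). [cite: HornJohnson2013, Thm 4.2.6] -/
theorem eigenvalues_mul_norm_sq_le_inner_apply_self (hT : T.IsSymmetric) {n : ℕ}
    (hn : finrank ℝ V = n) (k : Fin n) {x : V}
    (hx : ∀ i : Fin n, k < i → ⟪hT.eigenvectorBasis hn i, x⟫_ℝ = 0) :
    hT.eigenvalues hn k * ‖x‖ ^ 2 ≤ ⟪T x, x⟫_ℝ := by
  rw [inner_apply_self_eq_sum_eigenvalues hT hn x, ← (hT.eigenvectorBasis hn).sum_sq_inner_right x,
    Finset.mul_sum]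
  refine Finset.sum_le_sum fun i _ => ?_
  by_cases hi : k < i
  · rw [hx i hi]
    simp
  · exact mul_le_mul_of_nonneg_right (hT.eigenvalues_antitone hn (not_lt.mp hi)) (sq_nonneg _)

/-- In `Fin 3`, "for all `i < 1`" means "for `i = 0`". [folklore] -/
theorem forall_fin_three_lt_one {P : Fin 3 → Prop} (h : P 0) : ∀ i : Fin 3, i < 1 → P i := by
  intro i hi
  fin_cases i
  · exact h
  · exact absurd hi (by decide)
  · exact absurd hi (by decide)

/-- In `Fin 3`, "for all `i > 1`" means "for `i = 2`". [folklore] -/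
theorem forall_fin_three_one_lt {P : Fin 3 → Prop} (h : P 2) : ∀ i : Fin 3, 1 < i → P i := by
  intro i hi
  fin_cases i
  · exact absurd hi (by decide)
  · exact absurd hi (by decide)
  · exact h

/-- **Courant–Fischer for the middle eigenvalue of three, upper form.** For a symmetric operator
`T` on a three-dimensional real inner product space with eigenvalues `μ₀ ≥ μ₁ ≥ μ₂`,
`μ₁ ≤ a` iff the quadratic form of `T` is `≤ a |·|²` on some plane, the plane being given by an
orthonormal two-frame `v, w` (Horn–Johnson, Thm. 4.2.6, (4.2.7) with `n = 3`, `k = 2`: `λ₂ =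
min_{dim S = 2} max_{x ∈ S} x*Ax/x*x`, the minimum being attained). [cite: HornJohnson2013, Thm 4.2.6] -/
theorem eigenvalues_mid_le_iff (hT : T.IsSymmetric) (h3 : finrank ℝ V = 3) (a : ℝ) :
    hT.eigenvalues h3 1 ≤ a ↔ ∃ v w : V, ‖v‖ = 1 ∧ ‖w‖ = 1 ∧ ⟪v, w⟫_ℝ = 0 ∧
      ∀ α β : ℝ, ⟪T (α • v + β • w), α • v + β • w⟫_ℝ ≤ a * (α ^ 2 + β ^ 2) := by
  set b := hT.eigenvectorBasis h3
  have h1 : ‖b 1‖ = 1 := b.orthonormal.1 1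
  have h2 : ‖b 2‖ = 1 := b.orthonormal.1 2
  have h12 : ⟪b 1, b 2⟫_ℝ = 0 := b.orthonormal.2 (by decide)
  have h01 : ⟪b 0, b 1⟫_ℝ = 0 := b.orthonormal.2 (by decide)
  have h02 : ⟪b 0, b 2⟫_ℝ = 0 := b.orthonormal.2 (by decide)
  constructor
  · intro h
    refine ⟨b 1, b 2, h1, h2, h12, fun α β => ?_⟩
    have hx : ∀ i : Fin 3, i < 1 → ⟪b i, α • b 1 + β • b 2⟫_ℝ = 0 :=
      forall_fin_three_lt_one (P := fun i => ⟪b i, α • b 1 + β • b 2⟫_ℝ = 0)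
        (by simp [inner_add_right, real_inner_smul_right, h01, h02])
    calc ⟪T (α • b 1 + β • b 2), α • b 1 + β • b 2⟫_ℝ
        ≤ hT.eigenvalues h3 1 * ‖α • b 1 + β • b 2‖ ^ 2 :=
          inner_apply_self_le_eigenvalues_mul_norm_sq hT h3 1 hx
      _ = hT.eigenvalues h3 1 * (α ^ 2 + β ^ 2) := by rw [norm_sq_smul_add_smul h1 h2 h12]
      _ ≤ a * (α ^ 2 + β ^ 2) := mul_le_mul_of_nonneg_right h (by positivity)
  · rintro ⟨v, w, hv, hw, hvw, hq⟩
    obtain ⟨α, β, hpos, horth⟩ := exists_smul_add_smul_inner_eq_zero (b 2) v w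
    have hx : ∀ i : Fin 3, 1 < i → ⟪b i, α • v + β • w⟫_ℝ = 0 :=
      forall_fin_three_one_lt (P := fun i => ⟪b i, α • v + β • w⟫_ℝ = 0) horth
    have hlow := eigenvalues_mul_norm_sq_le_inner_apply_self hT h3 1 hx
    rw [norm_sq_smul_add_smul hv hw hvw] at hlow
    exact le_of_mul_le_mul_right (hlow.trans (hq α β)) hpos

/-- **Courant–Fischer for the middle eigenvalue of three, lower form.** With the notation of
`eigenvalues_mid_le_iff`: `a ≤ μ₁` iff the quadratic form of `T` is `≥ a |·|²` on some plane
(Horn–Johnson, Thm. 4.2.6, (4.2.8) with `n = 3`, `k = 2`: `λ₂ = max_{dim S = 2} min_{x ∈ S}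
x*Ax/x*x`, the maximum being attained). [cite: HornJohnson2013, Thm 4.2.6] -/
theorem le_eigenvalues_mid_iff (hT : T.IsSymmetric) (h3 : finrank ℝ V = 3) (a : ℝ) :
    a ≤ hT.eigenvalues h3 1 ↔ ∃ v w : V, ‖v‖ = 1 ∧ ‖w‖ = 1 ∧ ⟪v, w⟫_ℝ = 0 ∧
      ∀ α β : ℝ, a * (α ^ 2 + β ^ 2) ≤ ⟪T (α • v + β • w), α • v + β • w⟫_ℝ := by
  set b := hT.eigenvectorBasis h3
  have h0 : ‖b 0‖ = 1 := b.orthonormal.1 0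
  have h1 : ‖b 1‖ = 1 := b.orthonormal.1 1
  have h01 : ⟪b 0, b 1⟫_ℝ = 0 := b.orthonormal.2 (by decide)
  have h20 : ⟪b 2, b 0⟫_ℝ = 0 := b.orthonormal.2 (by decide)
  have h21 : ⟪b 2, b 1⟫_ℝ = 0 := b.orthonormal.2 (by decide)
  constructor
  · intro h
    refine ⟨b 0, b 1, h0, h1, h01, fun α β => ?_⟩
    have hx : ∀ i : Fin 3, 1 < i → ⟪b i, α • b 0 + β • b 1⟫_ℝ = 0 :=
      forall_fin_three_one_lt (P := fun i => ⟪b i, α • b 0 + β • b 1⟫_ℝ = 0)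
        (by simp [inner_add_right, real_inner_smul_right, h20, h21])
    calc a * (α ^ 2 + β ^ 2)
        ≤ hT.eigenvalues h3 1 * (α ^ 2 + β ^ 2) := mul_le_mul_of_nonneg_right h (by positivity)
      _ = hT.eigenvalues h3 1 * ‖α • b 0 + β • b 1‖ ^ 2 := by rw [norm_sq_smul_add_smul h0 h1 h01]
      _ ≤ ⟪T (α • b 0 + β • b 1), α • b 0 + β • b 1⟫_ℝ :=
          eigenvalues_mul_norm_sq_le_inner_apply_self hT h3 1 hx
  · rintro ⟨v, w, hv, hw, hvw, hq⟩
    obtain ⟨α, β, hpos, horth⟩ := exists_smul_add_smul_inner_eq_zero (b 0) v w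
    have hx : ∀ i : Fin 3, i < 1 → ⟪b i, α • v + β • w⟫_ℝ = 0 :=
      forall_fin_three_lt_one (P := fun i => ⟪b i, α • v + β • w⟫_ℝ = 0) horth
    have hup := inner_apply_self_le_eigenvalues_mul_norm_sq hT h3 1 hx
    rw [norm_sq_smul_add_smul hv hw hvw] at hup
    exact le_of_mul_le_mul_right ((hq α β).trans hup) hpos

/-- Eigenvalues of equal symmetric operators agree, also across two names `m = n` of the
dimension (transport lemma for `LinearMap.IsSymmetric.eigenvalues`). [folklore] -/
theorem eigenvalues_congr {S : V →ₗ[ℝ] V} (hS : S.IsSymmetric) (hT : T.IsSymmetric) (h : S = T)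
    {m n : ℕ} (hm : finrank ℝ V = m) (hn : finrank ℝ V = n) (hmn : m = n) (i : Fin m) :
    hS.eigenvalues hm i = hT.eigenvalues hn (Fin.cast hmn i) := by
  subst h hmn
  rfl

/-! ### The symmetric part and the principal strains -/

/-- `A + A†`: twice the symmetric part of a linear map of a finite-dimensional real inner product
space (for `A = ∇u(x)` this is `2S`, twice the strain-rate tensor `S = ½ (∇u + ∇uᵀ)` of
Miller 2019, Thm. 1.1; the coercion of `2 • strainRateWithin u univ x`). [folklore] -/
def addAdjoint (A : V →ₗ[ℝ] V) : V →ₗ[ℝ] V :=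
  A + LinearMap.adjoint A

/-- Unfolding `addAdjoint`. [folklore] -/
theorem addAdjoint_apply (A : V →ₗ[ℝ] V) (x : V) :
    addAdjoint A x = A x + LinearMap.adjoint A x := rfl

/-- `A + A†` is symmetric. [folklore] -/
theorem isSymmetric_addAdjoint (A : V →ₗ[ℝ] V) : (addAdjoint A).IsSymmetric := by
  intro x y
  simp only [addAdjoint_apply, inner_add_left, inner_add_right, LinearMap.adjoint_inner_left,
    LinearMap.adjoint_inner_right]
  exact add_comm _ _

/-- The quadratic form of `A + A†` is twice that of `A`: `⟪(A + A†) x, x⟫ = 2 ⟪A x, x⟫` (so the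
quadratic form of the strain `S` is that of `∇u`). [folklore] -/
theorem inner_addAdjoint_apply_self (A : V →ₗ[ℝ] V) (x : V) :
    ⟪addAdjoint A x, x⟫_ℝ = 2 * ⟪A x, x⟫_ℝ := by
  rw [addAdjoint_apply, inner_add_left, LinearMap.adjoint_inner_left, real_inner_comm (A x) x]
  ring

/-- The **principal strains** of `A`: the eigenvalues of the symmetric part `½ (A + A†)`, in
decreasing order `λ₀ ≥ λ₁ ≥ … ≥ λ_{n-1}` (Mathlib's enumeration `LinearMap.IsSymmetric.eigenvalues`
of `A + A†`, halved). For `A = ∇u(x)` on `ℝ³` these are the eigenvalues of the strain tensor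
`S = ∇_sym u` of Miller 2019, Thm. 1.1 (listed there increasingly). [cite: Miller2019, Thm 1.1] -/
def strainEigenvalues (A : V →ₗ[ℝ] V) {n : ℕ} (hn : finrank ℝ V = n) (i : Fin n) : ℝ :=
  2⁻¹ * (isSymmetric_addAdjoint A).eigenvalues hn i

/-- Unfolding `strainEigenvalues`. [folklore] -/
theorem strainEigenvalues_def (A : V →ₗ[ℝ] V) {n : ℕ} (hn : finrank ℝ V = n) (i : Fin n) :
    strainEigenvalues A hn i = 2⁻¹ * (isSymmetric_addAdjoint A).eigenvalues hn i := rfl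

/-- The principal strains are listed in decreasing order. [folklore] -/
theorem strainEigenvalues_antitone (A : V →ₗ[ℝ] V) {n : ℕ} (hn : finrank ℝ V = n) :
    Antitone (strainEigenvalues A hn) := fun _ _ hij =>
  mul_le_mul_of_nonneg_left ((isSymmetric_addAdjoint A).eigenvalues_antitone hn hij) (by norm_num)

/-- **Courant–Fischer for the middle principal strain of three (upper form)**, in terms of the
quadratic form of `A` itself: `λ₁(½(A + A†)) ≤ a` iff `⟪A (αv + βw), αv + βw⟫ ≤ a (α² + β²)` for
some orthonormal `v, w` and all `α, β`. [cite: HornJohnson2013, Thm 4.2.6] -/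
theorem strainEigenvalues_mid_le_iff (A : V →ₗ[ℝ] V) (h3 : finrank ℝ V = 3) (a : ℝ) :
    strainEigenvalues A h3 1 ≤ a ↔ ∃ v w : V, ‖v‖ = 1 ∧ ‖w‖ = 1 ∧ ⟪v, w⟫_ℝ = 0 ∧
      ∀ α β : ℝ, ⟪A (α • v + β • w), α • v + β • w⟫_ℝ ≤ a * (α ^ 2 + β ^ 2) := by
  rw [strainEigenvalues_def, inv_mul_le_iff₀ (by norm_num : (0 : ℝ) < 2),
    eigenvalues_mid_le_iff (isSymmetric_addAdjoint A) h3 (2 * a)]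
  simp only [inner_addAdjoint_apply_self]
  constructor <;> rintro ⟨v, w, hv, hw, hvw, h⟩ <;> refine ⟨v, w, hv, hw, hvw, fun α β => ?_⟩ <;>
    have := h α β <;> linarith

/-- **Courant–Fischer for the middle principal strain of three (lower form)**:
`a ≤ λ₁(½(A + A†))` iff `a (α² + β²) ≤ ⟪A (αv + βw), αv + βw⟫` for some orthonormal `v, w` and all
`α, β`. [cite: HornJohnson2013, Thm 4.2.6] -/
theorem le_strainEigenvalues_mid_iff (A : V →ₗ[ℝ] V) (h3 : finrank ℝ V = 3) (a : ℝ) :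
    a ≤ strainEigenvalues A h3 1 ↔ ∃ v w : V, ‖v‖ = 1 ∧ ‖w‖ = 1 ∧ ⟪v, w⟫_ℝ = 0 ∧
      ∀ α β : ℝ, a * (α ^ 2 + β ^ 2) ≤ ⟪A (α • v + β • w), α • v + β • w⟫_ℝ := by
  rw [strainEigenvalues_def, le_inv_mul_iff₀ (by norm_num : (0 : ℝ) < 2),
    le_eigenvalues_mid_iff (isSymmetric_addAdjoint A) h3 (2 * a)]
  simp only [inner_addAdjoint_apply_self]
  constructor <;> rintro ⟨v, w, hv, hw, hvw, h⟩ <;> refine ⟨v, w, hv, hw, hvw, fun α β => ?_⟩ <;>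
    have := h α β <;> linarith

end Rayleigh

/-! ### Three dimensions: matrices in the standard basis, the Leray gauge -/

section LerayGauge

/-- Local notation for physical space `ℝ³ = EuclideanSpace ℝ (Fin 3)`. -/
local notation "ℝ³" => EuclideanSpace ℝ (Fin 3)

/-- The matrix of a linear map of `ℝ³` in the standard orthonormal basis:
`stdMatrix A i j = (A eⱼ)ᵢ`; for `A = ∇u(x)` this is the velocity-gradient matrix `(∂ⱼ uᵢ)ᵢⱼ`
of the route's matrix items (an `abbrev` for `LinearMap.toMatrix` in `EuclideanSpace.basisFun`,
i.e. `Matrix.toEuclideanLin.symm`). [folklore] -/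
abbrev stdMatrix (A : ℝ³ →ₗ[ℝ] ℝ³) : Matrix (Fin 3) (Fin 3) ℝ :=
  LinearMap.toMatrix (EuclideanSpace.basisFun (Fin 3) ℝ).toBasis
    (EuclideanSpace.basisFun (Fin 3) ℝ).toBasis A

/-- Entries: `stdMatrix A i j = (A eⱼ)ᵢ` with `eⱼ = EuclideanSpace.single j 1`. [folklore] -/
theorem stdMatrix_apply (A : ℝ³ →ₗ[ℝ] ℝ³) (i j : Fin 3) :
    stdMatrix A i j = A (EuclideanSpace.single j 1) i := by
  unfold stdMatrix
  rw [LinearMap.toMatrix_apply, OrthonormalBasis.coe_toBasis_repr_apply,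
    OrthonormalBasis.coe_toBasis, EuclideanSpace.basisFun_apply, EuclideanSpace.basisFun_repr]

/-- `stdMatrix` inverts `Matrix.toEuclideanLin`. [folklore] -/
theorem toEuclideanLin_stdMatrix (A : ℝ³ →ₗ[ℝ] ℝ³) : Matrix.toEuclideanLin (stdMatrix A) = A := by
  unfold stdMatrix
  rw [Matrix.toEuclideanLin_eq_toLin_orthonormal, Matrix.toLin_toMatrix]

/-- The matrix of a composition is the product of the matrices. [folklore] -/
theorem stdMatrix_comp (A B : ℝ³ →ₗ[ℝ] ℝ³) : stdMatrix (A ∘ₗ B) = stdMatrix A * stdMatrix B :=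
  LinearMap.toMatrix_comp (EuclideanSpace.basisFun (Fin 3) ℝ).toBasis
    (EuclideanSpace.basisFun (Fin 3) ℝ).toBasis (EuclideanSpace.basisFun (Fin 3) ℝ).toBasis A B

/-- The trace of the matrix is the trace of the map (`= div u` for `A = ∇u(x)`, cf.
`VectorCalculus.divergence`). [folklore] -/
theorem trace_stdMatrix (A : ℝ³ →ₗ[ℝ] ℝ³) : (stdMatrix A).trace = LinearMap.trace ℝ ℝ³ A :=
  (LinearMap.trace_eq_matrix_trace ℝ (EuclideanSpace.basisFun (Fin 3) ℝ).toBasis A).symm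

/-- `M + Mᴴ` represents `A + A†` for `M = stdMatrix A` (for real matrices `Mᴴ = Mᵀ`). [folklore] -/
theorem toEuclideanLin_stdMatrix_add_conjTranspose (A : ℝ³ →ₗ[ℝ] ℝ³) :
    Matrix.toEuclideanLin (stdMatrix A + (stdMatrix A)ᴴ) = addAdjoint A := by
  rw [map_add, Matrix.toEuclideanLin_conjTranspose_eq_adjoint, toEuclideanLin_stdMatrix]
  rfl

/-- **Matrix bridge for the principal strains.** The principal strains of `A` are half the
`Matrix.IsHermitian.eigenvalues₀` of `M + Mᴴ`, `M = stdMatrix A` — the enumeration used by the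
route items `MiddleEigenvalueSign` / `BiaxialityDefect` (same decreasing order; the index is
transported along `Fintype.card (Fin 3) = 3`). [folklore] -/
theorem strainEigenvalues_eq_eigenvalues₀ (A : ℝ³ →ₗ[ℝ] ℝ³) (i : Fin 3) :
    strainEigenvalues A finrank_euclideanSpace_fin i =
      2⁻¹ * (Matrix.isHermitian_add_transpose_self (stdMatrix A)).eigenvalues₀
        (Fin.cast (Fintype.card_fin 3).symm i) := by
  rw [strainEigenvalues_def, Matrix.IsHermitian.eigenvalues₀]
  congr 1
  exact eigenvalues_congr _ _ (toEuclideanLin_stdMatrix_add_conjTranspose A).symm _ _ _ i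

/-- The squared Frobenius norm of a map of `ℝ³` is the sum of the squares of its matrix entries
(the form `∑ i, ∑ j, (M i j)^2` of the route's matrix items). [folklore] -/
theorem frobeniusNormSq_eq_sum_sq_stdMatrix (A : ℝ³ →L[ℝ] ℝ³) :
    frobeniusNormSq A = ∑ i, ∑ j, stdMatrix (A : ℝ³ →ₗ[ℝ] ℝ³) i j ^ 2 := by
  rw [frobeniusNormSq_eq_sum (EuclideanSpace.basisFun (Fin 3) ℝ) A, Finset.sum_comm]
  refine Finset.sum_congr rfl fun j _ => ?_
  rw [EuclideanSpace.norm_sq_eq]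
  refine Finset.sum_congr rfl fun i _ => ?_
  rw [stdMatrix_apply, ContinuousLinearMap.coe_coe, EuclideanSpace.basisFun_apply, Real.norm_eq_abs,
    sq_abs]

/-- The vorticity in terms of the velocity-gradient matrix `M = stdMatrix ∇v(y)` (`Mᵢⱼ = ∂ⱼvᵢ`):
`curl v y = (M₂₁ − M₁₂, M₀₂ − M₂₀, M₁₀ − M₀₁)` — the vector `ω` of the route item `SignLaw`, so that
`ω · S ω` there is the tree's `⟪curl v y, S (curl v y)⟫`. [folklore] -/
theorem curl_eq_stdMatrix (v : ℝ³ → ℝ³) (y : ℝ³) :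
    curl v y = WithLp.toLp 2
      ![stdMatrix (fderiv ℝ v y : ℝ³ →ₗ[ℝ] ℝ³) 2 1 - stdMatrix (fderiv ℝ v y : ℝ³ →ₗ[ℝ] ℝ³) 1 2,
        stdMatrix (fderiv ℝ v y : ℝ³ →ₗ[ℝ] ℝ³) 0 2 - stdMatrix (fderiv ℝ v y : ℝ³ →ₗ[ℝ] ℝ³) 2 0,
        stdMatrix (fderiv ℝ v y : ℝ³ →ₗ[ℝ] ℝ³) 1 0 - stdMatrix (fderiv ℝ v y : ℝ³ →ₗ[ℝ] ℝ³) 0 1] := by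
  simp only [curl, stdMatrix_apply, ContinuousLinearMap.coe_coe]

variable (u : ℝ → ℝ³ → ℝ³) (t : ℝ) (x : ℝ³)

/-- **The Leray-gauge middle strain eigenvalue** `Λ_u(t, x) = (−t) · λ₂(S(t, x))`, where
`S = ½ (∇u + ∇uᵀ)` is the strain tensor of the time slice `u t` at `x` (`∇u = fderiv ℝ (u t) x`)
and `λ₂` its middle eigenvalue (index `1` of the decreasing enumeration `strainEigenvalues`;
Miller 2019, Thm. 1.1, lists `λ₁ ≤ λ₂ ≤ λ₃`, the middle one is the same). The factor `−t` is the
backward self-similar (Leray) gauge for ancient solutions on `t < 0`: `Λ` is dimensionless and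
invariant under `u ↦ λ u(λ² t, λ x)`. Meaningful for `t < 0` only (`0` at `t = 0`); junk `0`
gradient where `u t` is not differentiable. Characterised by the two-plane forms
`lerayMiddleStrain_le_iff` / `le_lerayMiddleStrain_iff` (Courant–Fischer). [folklore] -/
def lerayMiddleStrain : ℝ :=
  (-t) * strainEigenvalues (fderiv ℝ (u t) x : ℝ³ →ₗ[ℝ] ℝ³) finrank_euclideanSpace_fin 1

/-- **The gauge nilpotency defect** `(−t) ‖∇u ∘ ∇u‖_F / ‖∇u‖_F` of the time slice `u t` at `x`
(Frobenius = Hilbert–Schmidt norms, `frobeniusNormSq`), in the Leray gauge (dimensionless,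
scaling invariant). It vanishes exactly when `(∇u)² = 0` (`gaugeNilpotencyDefect_eq_zero_iff`),
i.e. on the nilpotent gradients of rank `≤ 1`, `∇u = a ⊗ b` with `a · b = 0` (pure shear layers),
and measures the distance of `∇u` from that shear variety relative to its size. Value `0` when
`∇u = 0` (Lean's `x / 0 = 0`, which is the intended convention). Meaningful for `t < 0` only.
[folklore] -/
def gaugeNilpotencyDefect : ℝ :=
  (-t) * (√(frobeniusNormSq ((fderiv ℝ (u t) x).comp (fderiv ℝ (u t) x))) /
    √(frobeniusNormSq (fderiv ℝ (u t) x)))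

variable {u t x}

/-- Unfolding `lerayMiddleStrain`. [folklore] -/
theorem lerayMiddleStrain_def :
    lerayMiddleStrain u t x =
      (-t) * strainEigenvalues (fderiv ℝ (u t) x : ℝ³ →ₗ[ℝ] ℝ³) finrank_euclideanSpace_fin 1 := rfl

/-- Unfolding `gaugeNilpotencyDefect`. [folklore] -/
theorem gaugeNilpotencyDefect_def :
    gaugeNilpotencyDefect u t x =
      (-t) * (√(frobeniusNormSq ((fderiv ℝ (u t) x).comp (fderiv ℝ (u t) x))) /
        √(frobeniusNormSq (fderiv ℝ (u t) x))) := rfl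

/-- `c q ≤ a s ↔ q ≤ (a/c) s` for `c > 0` (moving the gauge factor across). [folklore] -/
private theorem mul_le_mul_iff_le_div_mul {c q a s : ℝ} (hc : 0 < c) :
    c * q ≤ a * s ↔ q ≤ a / c * s := by
  rw [div_mul_eq_mul_div, le_div_iff₀ hc, mul_comm]

/-- `a s ≤ c q ↔ (a/c) s ≤ q` for `c > 0` (moving the gauge factor across). [folklore] -/
private theorem mul_le_mul_iff_div_mul_le {c q a s : ℝ} (hc : 0 < c) :
    a * s ≤ c * q ↔ a / c * s ≤ q := by
  rw [div_mul_eq_mul_div, div_le_iff₀ hc, mul_comm c q]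

/-- **Courant–Fischer, upper form, in the Leray gauge** — literally the inline form of the route
items `MustSqueeze` / `ExtremalElementExists` / `ExtremalBiaxialitySubcritical`: for `t < 0`,
`Λ_u(t, x) ≤ a` iff the quadratic form of `(−t) ∇u(t, x)` is `≤ a |·|²` on some plane, given by an
orthonormal two-frame `v, w`. [cite: HornJohnson2013, Thm 4.2.6] -/
theorem lerayMiddleStrain_le_iff (ht : t < 0) (a : ℝ) :
    lerayMiddleStrain u t x ≤ a ↔ ∃ v w : ℝ³, ‖v‖ = 1 ∧ ‖w‖ = 1 ∧ inner ℝ v w = 0 ∧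
      ∀ α β : ℝ, (-t) * inner ℝ (fderiv ℝ (u t) x (α • v + β • w)) (α • v + β • w) ≤
        a * (α ^ 2 + β ^ 2) := by
  have ht' : 0 < -t := neg_pos.mpr ht
  rw [lerayMiddleStrain_def, mul_comm, ← le_div_iff₀ ht', strainEigenvalues_mid_le_iff]
  simp only [ContinuousLinearMap.coe_coe, mul_le_mul_iff_le_div_mul ht']

/-- **Courant–Fischer, lower form, in the Leray gauge** — literally the inline form of the route
items `ExtremalElementExists` / `ExtremalBiaxialitySubcritical`: for `t < 0`, `m ≤ Λ_u(t, x)` iff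
the quadratic form of `(−t) ∇u(t, x)` is `≥ m |·|²` on some plane, given by an orthonormal
two-frame `v, w`. [cite: HornJohnson2013, Thm 4.2.6] -/
theorem le_lerayMiddleStrain_iff (ht : t < 0) (m : ℝ) :
    m ≤ lerayMiddleStrain u t x ↔ ∃ v w : ℝ³, ‖v‖ = 1 ∧ ‖w‖ = 1 ∧ inner ℝ v w = 0 ∧
      ∀ α β : ℝ, m * (α ^ 2 + β ^ 2) ≤
        (-t) * inner ℝ (fderiv ℝ (u t) x (α • v + β • w)) (α • v + β • w) := by
  have ht' : 0 < -t := neg_pos.mpr ht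
  rw [lerayMiddleStrain_def, mul_comm, ← div_le_iff₀ ht', le_strainEigenvalues_mid_iff]
  simp only [ContinuousLinearMap.coe_coe, mul_le_mul_iff_div_mul_le ht']

/-- **Matrix form of the Leray-gauge middle strain eigenvalue**: `Λ_u(t,x) = (−t) · ½ μ₁` with
`μ₀ ≥ μ₁ ≥ μ₂` the `Matrix.IsHermitian.eigenvalues₀` of `M + Mᴴ`, `M = stdMatrix ∇u(t, x)` the
velocity-gradient matrix — the quantity of the route items `MiddleEigenvalueSign` /
`BiaxialityDefect`. [folklore] -/
theorem lerayMiddleStrain_eq_eigenvalues₀ :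
    lerayMiddleStrain u t x = (-t) * (2⁻¹ *
      (Matrix.isHermitian_add_transpose_self (stdMatrix (fderiv ℝ (u t) x : ℝ³ →ₗ[ℝ] ℝ³))).eigenvalues₀
        1) := by
  have hc : Fin.cast (Fintype.card_fin 3).symm (1 : Fin 3) = 1 := Fin.ext (by simp)
  rw [lerayMiddleStrain_def, strainEigenvalues_eq_eigenvalues₀, hc]

/-- The gauge nilpotency defect is nonnegative for `t ≤ 0`. [folklore] -/
theorem gaugeNilpotencyDefect_nonneg (ht : t ≤ 0) : 0 ≤ gaugeNilpotencyDefect u t x := by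
  rw [gaugeNilpotencyDefect_def]
  exact mul_nonneg (neg_nonneg.mpr ht) (div_nonneg (Real.sqrt_nonneg _) (Real.sqrt_nonneg _))

/-- A map of `ℝ³` with vanishing Frobenius norm is zero. [folklore] -/
theorem frobeniusNormSq_eq_zero_iff (A : ℝ³ →L[ℝ] ℝ³) : frobeniusNormSq A = 0 ↔ A = 0 := by
  refine ⟨fun h => ?_, fun h => by rw [h, frobeniusNormSq_zero]⟩
  rw [frobeniusNormSq_eq_sum (EuclideanSpace.basisFun (Fin 3) ℝ) A,
    Finset.sum_eq_zero_iff_of_nonneg fun _ _ => sq_nonneg _] at h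
  have hb : ∀ j, A (EuclideanSpace.basisFun (Fin 3) ℝ j) = 0 := fun j =>
    norm_eq_zero.mp ((pow_eq_zero_iff two_ne_zero).mp (h j (Finset.mem_univ j)))
  exact ContinuousLinearMap.coe_injective
    ((EuclideanSpace.basisFun (Fin 3) ℝ).toBasis.ext fun j => by simpa using hb j)

/-- **The defect vanishes exactly on the nilpotent gradients**: for `t < 0`,
`gaugeNilpotencyDefect u t x = 0 ↔ ∇u(t,x) ∘ ∇u(t,x) = 0` (including `∇u = 0`); in `ℝ³` the
nonzero solutions of `A² = 0` are the rank-one maps `a ⊗ b` with `a · b = 0`. [folklore] -/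
theorem gaugeNilpotencyDefect_eq_zero_iff (ht : t < 0) :
    gaugeNilpotencyDefect u t x = 0 ↔ (fderiv ℝ (u t) x).comp (fderiv ℝ (u t) x) = 0 := by
  have ht' : (-t) ≠ 0 := (neg_pos.mpr ht).ne'
  have key : √(frobeniusNormSq ((fderiv ℝ (u t) x).comp (fderiv ℝ (u t) x))) /
      √(frobeniusNormSq (fderiv ℝ (u t) x)) = 0 ↔
        (fderiv ℝ (u t) x).comp (fderiv ℝ (u t) x) = 0 := by
    rw [div_eq_zero_iff, Real.sqrt_eq_zero (frobeniusNormSq_nonneg _),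
      Real.sqrt_eq_zero (frobeniusNormSq_nonneg _), frobeniusNormSq_eq_zero_iff,
      frobeniusNormSq_eq_zero_iff]
    exact ⟨fun h => h.elim id fun h0 => by rw [h0, ContinuousLinearMap.comp_zero], Or.inl⟩
  rw [gaugeNilpotencyDefect_def, mul_eq_zero, key, or_iff_right_iff_imp]
  exact fun h => absurd h ht'

/-- **Matrix form of the defect**: `(−t) √(∑ᵢⱼ (M²)ᵢⱼ²) / √(∑ᵢⱼ Mᵢⱼ²)` with `M = stdMatrix ∇u(t,x)`
(the Frobenius sums of the route's matrix items). [folklore] -/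
theorem gaugeNilpotencyDefect_eq_matrix :
    gaugeNilpotencyDefect u t x =
      (-t) * (√(∑ i, ∑ j, (stdMatrix (fderiv ℝ (u t) x : ℝ³ →ₗ[ℝ] ℝ³) *
          stdMatrix (fderiv ℝ (u t) x : ℝ³ →ₗ[ℝ] ℝ³)) i j ^ 2) /
        √(∑ i, ∑ j, stdMatrix (fderiv ℝ (u t) x : ℝ³ →ₗ[ℝ] ℝ³) i j ^ 2)) := by
  rw [gaugeNilpotencyDefect_def, frobeniusNormSq_eq_sum_sq_stdMatrix,
    frobeniusNormSq_eq_sum_sq_stdMatrix, ContinuousLinearMap.toLinearMap_comp, stdMatrix_comp]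

end LerayGauge

end Literature.Analysis.FluidPDE
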